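import Summits.KontsevichZagierPeriods.KontsevichZagierPeriods.Theorems.LiouvilleUnfoldingAyoubPiCancellationBandFinishing
import Summits.KontsevichZagierPeriods.KontsevichZagierPeriods.Theorems.TerasomaMultiplicationBetaCancellationStubPiMulFibred
import Literature.NumberTheory.Transcendental.KZFibredRelations
import Literature.NumberTheory.Transcendental.KZProductIdeal

/-!
# Crux stmt-KontsevichZagierPeriods-0540 (`LiouvilleUnfolding.AyoubPiCancellation` ≡ `KZ.PiCancellation`),
# line `Sketch` (idea `moving-segment-wronskian`): stub `stub_bandReductionIff` (side theorem)

Support file (`--supports` stmt-KontsevichZagierPeriods-0540) of the line skeleton, registered stub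
`stub_bandReductionIff` (S, side theorem) — **item 0540 ⟺ BAND-FIBRED REDUCTION**: π-cancellation
(`AyoubPiCancellation`: for every pinned disc family `P n r = [{z : ℝⁿ⁺² | z 0² + z 1² ≤ 1,
tail z ∈ σ_r}, g_r ∘ tail]`, `lift (of ∘ P) c ∈ relations → c ∈ relations`) holds iff every
certificate of `[π]·c` (`lift (of ∘ P) c ∈ relations`) can be traded for a `z₀`-FIBRED certificate
(`KZ.fibredRelations`) of the interior BAND family
`B n r = [{z : ℝⁿ⁺² | z 0² + z 1² ≤ 1, a < z 0 < b, tail z ∈ σ_r}, g_r ∘ tail]`, for every rational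
`-1 < a < b < 1` and every pinned band family `B`.

Proof. A pinned band family IS the slab restriction of a pinned disc family:
`B n r = (P n r).slabRestrict a b` (`KZ.IntegralRep.ext'`; `band_eq_slabRestrict`,
`slabRestrict_isBand`), hence `lift (of ∘ B) = slabMap a b ∘ lift (of ∘ P)` on `FormalRep`
(`FreeAbelianGroup.lift_unique`, `KZ.slabMap_of`; `lift_band_eq_slabMap_lift`).
(→): the crux gives `c ∈ relations`; `BetaCancellationLine.stub_piMulFibred` makes the disc family
`lift (of ∘ P) c` a fibred relation, and fibred relations are stable under slab restriction
(`KZ.slabMap_mem_fibredRelations`). (←): take the band `(-1/2, 1/2)` and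
`B n r = (P n r).slabRestrict (-1/2) (1/2)`; the hypothesis yields a fibred band certificate, and
band finishing `stub_bandFinishing` ((A2) of the line) gives `c ∈ relations`.
No definitions; sorry-free; axioms ⊆ {propext, Classical.choice, Quot.sound}.

References: M. Kontsevich, D. Zagier, *Periods* (2001), §1.2 (rules (1)–(3)), §4.1; J. Ayoub,
*Une version relative de la conjecture des périodes de Kontsevich–Zagier*, Ann. of Math. 181
(2015), §1.
-/

noncomputable section

-- `Summit.KontsevichZagierPeriods.KontsevichZagierPeriods.…` is the tree's mandated layout (single-conjunct summit).
set_option linter.dupNamespace false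

namespace Summit.KontsevichZagierPeriods.KontsevichZagierPeriods.AyoubPiCancellationLine

open Set
open Literature.NumberTheory.Transcendental
open Literature.NumberTheory.Transcendental.KZ
open Summit.KontsevichZagierPeriods.KontsevichZagierPeriods.BetaCancellationLine (stub_piMulFibred)

/-! ### Band families are slab restrictions of disc families -/

/-- **The slab restriction of a pinned disc family is a pinned band family**: restricting
`P n r = [{z | z 0² + z 1² ≤ 1, tail z ∈ σ_r}, g_r ∘ tail]` to the slab `{a < z 0 < b}` gives the
domain `{z | z 0² + z 1² ≤ 1, a < z 0 < b, tail z ∈ σ_r}` and keeps the integrand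
(`KZ.IntegralRep.domain_slabRestrict`, `KZ.IntegralRep.integrand_slabRestrict`). [folklore] -/
theorem slabRestrict_isBand (a b : ℚ)
    (P : ∀ n : ℕ, IntegralRep n → IntegralRep (n + 2))
    (hP : ∀ (n : ℕ) (r : IntegralRep n),
      (P n r).domain = {z : Fin (n + 2) → ℝ | z 0 ^ 2 + z 1 ^ 2 ≤ 1 ∧
        (fun i : Fin n => z i.succ.succ) ∈ r.domain} ∧
      (P n r).integrand = fun z => r.integrand (fun i : Fin n => z i.succ.succ)) :
    ∀ (n : ℕ) (r : IntegralRep n),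
      ((P n r).slabRestrict a b).domain = {z : Fin (n + 2) → ℝ | z 0 ^ 2 + z 1 ^ 2 ≤ 1 ∧
        ((a : ℝ) < z 0 ∧ z 0 < b) ∧ (fun i : Fin n => z i.succ.succ) ∈ r.domain} ∧
      ((P n r).slabRestrict a b).integrand = fun z => r.integrand (fun i : Fin n => z i.succ.succ) := by
  intro n r
  refine ⟨?_, ?_⟩
  · rw [IntegralRep.domain_slabRestrict, (hP n r).1]
    ext z
    simp only [mem_inter_iff, mem_setOf_eq, paramSlab]
    exact ⟨fun h => ⟨h.1.1, h.2, h.1.2⟩, fun h => ⟨⟨h.1, h.2.2⟩, h.2.1⟩⟩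
  · rw [IntegralRep.integrand_slabRestrict, (hP n r).2]

/-- **A pinned band family IS the slab restriction of a pinned disc family**: both have domain
`{z | z 0² + z 1² ≤ 1, a < z 0 < b, tail z ∈ σ_r}` and integrand `g_r ∘ tail`, and an integral
representation is determined by its domain and integrand (`KZ.IntegralRep.ext'`). [folklore] -/
theorem band_eq_slabRestrict (a b : ℚ)
    (P : ∀ n : ℕ, IntegralRep n → IntegralRep (n + 2))
    (hP : ∀ (n : ℕ) (r : IntegralRep n),
      (P n r).domain = {z : Fin (n + 2) → ℝ | z 0 ^ 2 + z 1 ^ 2 ≤ 1 ∧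
        (fun i : Fin n => z i.succ.succ) ∈ r.domain} ∧
      (P n r).integrand = fun z => r.integrand (fun i : Fin n => z i.succ.succ))
    (B : ∀ n : ℕ, IntegralRep n → IntegralRep (n + 2))
    (hB : ∀ (n : ℕ) (r : IntegralRep n),
      (B n r).domain = {z : Fin (n + 2) → ℝ | z 0 ^ 2 + z 1 ^ 2 ≤ 1 ∧ ((a : ℝ) < z 0 ∧ z 0 < b) ∧
        (fun i : Fin n => z i.succ.succ) ∈ r.domain} ∧
      (B n r).integrand = fun z => r.integrand (fun i : Fin n => z i.succ.succ))
    (n : ℕ) (r : IntegralRep n) :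
    B n r = (P n r).slabRestrict a b :=
  IntegralRep.ext' ((hB n r).1.trans (slabRestrict_isBand a b P hP n r).1.symm)
    ((hB n r).2.trans (slabRestrict_isBand a b P hP n r).2.symm)

/-- **The band certificate is the slab restriction of the disc certificate**:
`lift (of ∘ B) c = slabMap a b (lift (of ∘ P) c)` for every formal combination `c` — two additive
maps out of the free abelian group `FormalRep` that agree on generators
(`FreeAbelianGroup.lift_unique`; on `[r]`: `KZ.slabMap_of` and `band_eq_slabRestrict`). [folklore] -/
theorem lift_band_eq_slabMap_lift (a b : ℚ)
    (P : ∀ n : ℕ, IntegralRep n → IntegralRep (n + 2))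
    (hP : ∀ (n : ℕ) (r : IntegralRep n),
      (P n r).domain = {z : Fin (n + 2) → ℝ | z 0 ^ 2 + z 1 ^ 2 ≤ 1 ∧
        (fun i : Fin n => z i.succ.succ) ∈ r.domain} ∧
      (P n r).integrand = fun z => r.integrand (fun i : Fin n => z i.succ.succ))
    (B : ∀ n : ℕ, IntegralRep n → IntegralRep (n + 2))
    (hB : ∀ (n : ℕ) (r : IntegralRep n),
      (B n r).domain = {z : Fin (n + 2) → ℝ | z 0 ^ 2 + z 1 ^ 2 ≤ 1 ∧ ((a : ℝ) < z 0 ∧ z 0 < b) ∧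
        (fun i : Fin n => z i.succ.succ) ∈ r.domain} ∧
      (B n r).integrand = fun z => r.integrand (fun i : Fin n => z i.succ.succ))
    (c : FormalRep) :
    FreeAbelianGroup.lift (fun s : (Σ n, IntegralRep n) => of (B s.1 s.2)) c =
      slabMap a b (FreeAbelianGroup.lift (fun s : (Σ n, IntegralRep n) => of (P s.1 s.2)) c) := by
  rw [← AddMonoidHom.comp_apply (slabMap a b)]
  refine (FreeAbelianGroup.lift_unique _ _ (fun s => ?_)).symm
  obtain ⟨m, t⟩ := s
  rw [AddMonoidHom.comp_apply, FreeAbelianGroup.lift_apply_of, band_eq_slabRestrict a b P hP B hB m t]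
  exact slabMap_of (n := m + 1) a b (P m t)

/-! ### The stub -/

/-- **STUB `stub_bandReductionIff`** (S, side theorem) of the line `Sketch` — **item 0540 ⟺
BAND-FIBRED REDUCTION**: π-cancellation holds iff every certificate of `[π]·c` can be traded for a
`z₀`-FIBRED certificate of ONE interior band family `[D ∩ {a < z₀ < b}] ⊗ c`. (→): the crux gives
`c ∈ relations`, `BetaCancellationLine.stub_piMulFibred` makes the disc family of `c` a fibred
relation, and the band family is its slab restriction (`KZ.slabMap_mem_fibredRelations`;
`B n r = (P n r).slabRestrict a b` by `KZ.IntegralRep.ext'`, `lift_band_eq_slabMap_lift`).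
(←): band finishing `stub_bandFinishing` (A2) on the band `(-1/2, 1/2)`, with
`B n r = (P n r).slabRestrict (-1/2) (1/2)` (`slabRestrict_isBand`). [folklore] -/
theorem stub_bandReductionIff :
    Summit.KontsevichZagierPeriods.KontsevichZagierPeriods.Theses.AyoubSpecialisation.AyoubPiCancellation ↔
    ∀ (P : ∀ n : ℕ, IntegralRep n → IntegralRep (n + 2)),
      (∀ (n : ℕ) (r : IntegralRep n),
        (P n r).domain = {z : Fin (n + 2) → ℝ | z 0 ^ 2 + z 1 ^ 2 ≤ 1 ∧
          (fun i : Fin n => z i.succ.succ) ∈ r.domain} ∧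
        (P n r).integrand = fun z => r.integrand (fun i : Fin n => z i.succ.succ)) →
      ∀ c : FormalRep,
        FreeAbelianGroup.lift (fun s : (Σ n, IntegralRep n) => of (P s.1 s.2)) c ∈ relations →
        ∀ (a b : ℚ), -1 < a → a < b → b < 1 →
        ∀ (B : ∀ n : ℕ, IntegralRep n → IntegralRep (n + 2)),
          (∀ (n : ℕ) (r : IntegralRep n),
            (B n r).domain = {z : Fin (n + 2) → ℝ | z 0 ^ 2 + z 1 ^ 2 ≤ 1 ∧ ((a : ℝ) < z 0 ∧ z 0 < b) ∧
              (fun i : Fin n => z i.succ.succ) ∈ r.domain} ∧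
            (B n r).integrand = fun z => r.integrand (fun i : Fin n => z i.succ.succ)) →
          FreeAbelianGroup.lift (fun s : (Σ n, IntegralRep n) => of (B s.1 s.2)) c ∈ fibredRelations := by
  constructor
  · -- (→): `c ∈ relations`, the disc certificate is fibred, and the band certificate is its slab restriction
    intro h P hP c hc a b _ha _hab _hb B hB
    have hcR : c ∈ relations := h P hP c hc
    have hfib := stub_piMulFibred P hP c hcR
    rw [lift_band_eq_slabMap_lift a b P hP B hB c]
    exact slabMap_mem_fibredRelations hfib a b
  · -- (←): band finishing on the band `(-1/2, 1/2)`
    intro h P hP c hc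
    have hB := slabRestrict_isBand (-1 / 2) (1 / 2) P hP
    exact stub_bandFinishing (-1 / 2) (1 / 2) (by norm_num) (by norm_num) (by norm_num)
      (fun n r => (P n r).slabRestrict (-1 / 2) (1 / 2)) hB c
      (h P hP c hc (-1 / 2) (1 / 2) (by norm_num) (by norm_num) (by norm_num)
        (fun n r => (P n r).slabRestrict (-1 / 2) (1 / 2)) hB)

end Summit.KontsevichZagierPeriods.KontsevichZagierPeriods.AyoubPiCancellationLine
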